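import Mathlib
import HarnessLib
import Summits.QuantumAdvantage.AdviceFreeQNC0.OddPrimeTransport
import Summits.QuantumAdvantage.AdviceFreeQNC0.OddPrimeWitnesses
import Summits.QuantumAdvantage.AdviceFreeQNC0.WalkHardFJunta
import Summits.QuantumAdvantage.AdviceFreeQNC0.WalkFailFloor
import Summits.QuantumAdvantage.AdviceFreeQNC0.CombGateJ37Fibre
import Summits.QuantumAdvantage.QuantumAdvantage.Theorems.WalkThreeCharge
import Summits.QuantumAdvantage.QuantumAdvantage.Theorems.PairFreezingG
import Summits.QuantumAdvantage.AdviceFreeQNC0.ExactHit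
import Summits.QuantumAdvantage.QuantumAdvantage.Theorems.RigidityLawsA
import Summits.QuantumAdvantage.QuantumAdvantage.Theorems.RigidityLawsB

/-!
# RegisterRotation — the `𝔽₄`-register class of low-degree walk strategies is closed under `ω`, almost everywhere
(cell decomp-qadv, lens 4, generation 12; tree twin of the workshop node `SmoothDial`)

Supports tree item 26994 (`FeatureShadow.Target` : `∀ p ≥ 5 prime, WalkHardF p`).  Sorry-free over landed modules only
(`WalkThreeCharge`, `WalkFailFloor`, `CombGateJ37Fibre`, `PairFreezingG` (for `wtPrefix_succ`, `GapFibre`), `WalkHardFJunta`,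
`OddPrimeTransport`, `OddPrimeWitnesses`); every hardness statement is INLINED (no `def … : Prop`).  The workshop node
`pub/decomp-qadv/decomp-qadv-lens-4/g12/SmoothDial.lean` states the same content against named `Prop`s
(`SmoothHardAt`, `RigidHardAt`, …, `closes`).

## Content
* §1 charge laws (`RigidityLaws.ringWinU_congr_mod`, `RigidityLaws.threeCharge` = landed `Coset21.threeCharge_holds`), cutwise XOR `xorStrat`
  (`ringWinU_xorStrat`, `hasDegF_xorStrat`), scaling `mulStrat` (`ringWinU_mulStrat`, `hasDegF_and`, `hasDegF_not`).
* §2 the `𝔽₄` REGISTER `reg y u = Σ_g [y_g(u)]·ω^{g + e_g(u)}`: `[WIN_c(y)(u)] = tr(ω^c·R_y(u))` (`iotaF_ringWinU_reg`, from the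
  landed `iotaF_ringWinU`), `reg_xorStrat`, `reg_mulStrat`, `ringWinU_of_reg_rotate` (`R_{y'} = ω·R_y ⟹ WIN_c(y') = WIN_{c+1}(y)`).
* §3 **THE ROTATION LEMMA** `rotation`: for `2m ≤ n` and selections of `𝔽_p`-degree `d ≥ 1`, the strategy `rot m y`
  (re-file each fired cut `g` at the nearest cut `h` on a fixed side with `e_h(u) ≡ e_g(u) + 1 (mod 3)`, XOR on collisions)
  has degree `≤ (6m+1)·d` (`hasDegF_rot`, via the landed `GapFibre.ind_mem_lowDeg_of_pattern`) and register `ω·R_y`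
  (`reg_rot`, `ringWinU_rot`) outside the `y`-independent set `bad m n` of `≤ (n+1)·2^{n−m}` inputs (`card_bad_le`; a failed
  search forces the alternating bit pattern `u_i = [(i+g) even]` on an `m`-window, `pattern_of_missR/L`, counted by the
  landed `Comb37J.card_agree`).  Loss-free CHARGE TRANSFER for every prime `p` (cf. the `θ`-lossy `p = 2` transfer
  `walkHardAll_of_ringHardU`).
* §4 SMOOTHING (`smoothing_rigid`, `smooth_of_rigid`): two-charge RIGIDITY hardness for strategies of degree `d ≥ rotDeg D`
  bounds the SMOOTH wins `#{u : WIN_c(y)(u) ∧ (WIN_{c+1}(y)(u) ↔ f u)}` for side tests `f` of degree `D`, constant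
  `θ ↦ (1+θ)/2`; corollaries: `smoothHard_polylog_iff_rigidHard` (at polylog side degree, smooth hardness IS two-charge
  rigidity hardness — rotation pays `(log₂ n)^3`), `smooth_of_walkHardF`, `rigid_of_smooth`, `smooth_full_iff_walkHardF`
  (side degree `n` = `WalkHardF`), `smooth_quart_of_rigid` (the attack edge at side degree `n^{1/4}`).
-/

set_option linter.dupNamespace false

namespace Summit.QuantumAdvantage.AdviceFreeQNC0.RegisterRotation

open Classical
open Finset
open Summit.QuantumAdvantage.AdviceFreeQNC0
open Literature.Computability.MetaComplexity Literature.Computability.MetaComplexity.Smolensky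

variable {n : ℕ}

/-! ## §1 Charge laws, XOR, scaling -/

/-- cutwise XOR of two strategies. -/
def xorStrat (y y' : Fin (n + 1) → (Fin n → Bool) → Bool) : Fin (n + 1) → (Fin n → Bool) → Bool :=
  fun g u => Bool.xor (y g u) (y' g u)

/-- the cutwise XOR of two degree-`d` strategies has degree `d`. -/
theorem hasDegF_xorStrat {p : ℕ} [Fact p.Prime] {d d' : ℕ} {y y' : Fin (n + 1) → (Fin n → Bool) → Bool}
    (hy : ∀ g, HasDegF p (y g) d) (hy' : ∀ g, HasDegF p (y' g) d') (g : Fin (n + 1)) :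
    HasDegF p (xorStrat y y' g) (d + d') :=
  RigidityLaws.hasDegF_xor (hy g) (hy' g)

/-- **character law**: `WIN_c(y ⊕ y') = WIN_c(y) ⊕ WIN_c(y')` pointwise (the live fired set of `y ⊕ y'` is
the symmetric difference of the two live fired sets). -/
theorem ringWinU_xorStrat (c : ℕ) (y y' : Fin (n + 1) → (Fin n → Bool) → Bool) (u : Fin n → Bool) :
    ringWinU c (xorStrat y y') u = Bool.xor (ringWinU c y u) (ringWinU c y' u) := by
  unfold ringWinU
  symm
  apply Coset21.xor_decide_of_sum
    (F := (univ.filter fun g : Fin (n + 1) =>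
        xorStrat y y' g u = true ∧ (c + g.val + walkExp u g.val) % 3 ≠ 0).card +
      (univ.filter fun g : Fin (n + 1) =>
        (y g u = true ∧ y' g u = true) ∧ (c + g.val + walkExp u g.val) % 3 ≠ 0).card)
  have key : ∀ g : Fin (n + 1),
      (if y g u = true ∧ (c + g.val + walkExp u g.val) % 3 ≠ 0 then 1 else 0) +
        (if y' g u = true ∧ (c + g.val + walkExp u g.val) % 3 ≠ 0 then 1 else 0) +
        (if xorStrat y y' g u = true ∧ (c + g.val + walkExp u g.val) % 3 ≠ 0 then 1 else 0) =
      2 * ((if xorStrat y y' g u = true ∧ (c + g.val + walkExp u g.val) % 3 ≠ 0 then 1 else 0) +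
        (if (y g u = true ∧ y' g u = true) ∧ (c + g.val + walkExp u g.val) % 3 ≠ 0 then 1 else 0)) := by
    intro g
    unfold xorStrat
    by_cases hL : (c + g.val + walkExp u g.val) % 3 ≠ 0 <;> cases y g u <;> cases y' g u <;> simp [hL]
  simp only [Finset.card_filter]
  rw [← Finset.sum_add_distrib, ← Finset.sum_add_distrib, ← Finset.sum_add_distrib, Finset.mul_sum]
  exact Finset.sum_congr rfl fun g _ => key g


/-- SMOOTH WIN at charge `c` against the side test `f`: `y` wins at `c` on `u` and its side bit (win at `c+1`)
equals `f u`. -/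
def smoothWin (c : ℕ) (y : Fin (n + 1) → (Fin n → Bool) → Bool) (f : (Fin n → Bool) → Bool)
    (u : Fin n → Bool) : Bool :=
  ringWinU c y u && (ringWinU (c + 1) y u == f u)


/-- pointwise: a smooth win is a win. -/
theorem win_of_smoothWin (c : ℕ) (y : Fin (n + 1) → (Fin n → Bool) → Bool) (f : (Fin n → Bool) → Bool)
    (u : Fin n → Bool) (h : smoothWin c y f u = true) : ringWinU c y u = true := by
  unfold smoothWin at h
  revert h
  cases ringWinU c y u <;> simp


/-- with the constant side test `true`, a smooth win at `k+1` is exactly RIGID at `k`. -/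
theorem smoothWin_true_iff (k : ℕ) (y : Fin (n + 1) → (Fin n → Bool) → Bool) (u : Fin n → Bool) :
    smoothWin (k + 1) y (fun _ => true) u = true ↔
      (ringWinU (k + 1) y u = true ∧ ringWinU (k + 2) y u = true) := by
  unfold smoothWin
  rw [show k + 1 + 1 = k + 2 by ring]
  cases ringWinU (k + 1) y u <;> cases ringWinU (k + 2) y u <;> simp


/-- every Boolean function on `n` bits has `𝔽_p`-degree `≤ n`. -/
theorem hasDegF_le_n (p : ℕ) [Fact p.Prime] (f : (Fin n → Bool) → Bool) : HasDegF p f n := by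
  have h := hasDegF_of_junta (p := p) (univ : Finset (Fin n)) f (fun u v huv => by
    have : u = v := funext fun i => huv i (mem_univ i)
    rw [this])
  rwa [Finset.card_univ, Fintype.card_fin] at h


/-! ## §5 SCALING BY A BOOLEAN FUNCTION; THE `𝔽₄` REGISTER (new, g12)

`mulStrat f y` fires `y`'s cuts only where `f` holds: `WIN_c(f·y) = f ∧ WIN_c(y)` pointwise, degree `deg f + deg y`.
The register `R_y(u) = Σ_g [y_g(u)]·ω^{g + e_g(u)} ∈ 𝔽₄` (over the landed `F4` toolkit of `WalkCharacters.lean`)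
linearises the game: `[WIN_c(y)(u)] = tr(ω^c·R_y(u))` (landed `iotaF_ringWinU`), `R_{y ⊕ y'} = R_y + R_{y'}`,
`R_{f·y} = [f]·R_y`.  WIN at `c` ⟺ `ω^c R ∈ {ω, ω²}`; RIGID ⟺ `R` is one prescribed unit; DEAD ⟺ `R = 0`. -/

/-- the strategy `f · y`: fire `y`'s cuts only on inputs where `f` holds. -/
def mulStrat (f : (Fin n → Bool) → Bool) (y : Fin (n + 1) → (Fin n → Bool) → Bool) :
    Fin (n + 1) → (Fin n → Bool) → Bool :=
  fun g u => f u && y g u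

/-- `WIN_c(f·y)(u) = f(u) ∧ WIN_c(y)(u)`. -/
theorem ringWinU_mulStrat (c : ℕ) (f : (Fin n → Bool) → Bool) (y : Fin (n + 1) → (Fin n → Bool) → Bool)
    (u : Fin n → Bool) : ringWinU c (mulStrat f y) u = (f u && ringWinU c y u) := by
  unfold ringWinU mulStrat
  cases f u <;> simp

/-- degrees add under conjunction: `[f ∧ f'] = [f]·[f']`. -/
theorem hasDegF_and {p : ℕ} [Fact p.Prime] {d d' : ℕ} {f f' : (Fin n → Bool) → Bool}
    (hf : HasDegF p f d) (hf' : HasDegF p f' d') : HasDegF p (fun x => f x && f' x) (d + d') := by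
  unfold HasDegF at *
  have key : (fun x : Fin n → Bool => if (f x && f' x) = true then (1 : ZMod p) else 0) =
      (fun x => if f x = true then (1 : ZMod p) else 0) * (fun x => if f' x = true then (1 : ZMod p) else 0) := by
    funext x
    simp only [Pi.mul_apply]
    cases f x <;> cases f' x <;> simp
  rw [key]
  exact mul_mem_lowDeg_add hf hf'

/-- negation keeps the degree: `[¬f] = 1 − [f]`. -/
theorem hasDegF_not {p : ℕ} [Fact p.Prime] {d : ℕ} {f : (Fin n → Bool) → Bool} (hf : HasDegF p f d) :
    HasDegF p (fun x => !f x) d := by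
  have h1 : HasDegF p (fun _ : Fin n → Bool => true) d := RigidityLaws.hasDegF_const p true d
  unfold HasDegF at *
  have key : (fun x : Fin n → Bool => if (!f x) = true then (1 : ZMod p) else 0) =
      (fun x : Fin n → Bool => if (fun _ : Fin n → Bool => true) x = true then (1 : ZMod p) else 0) -
        (fun x => if f x = true then (1 : ZMod p) else 0) := by
    funext x
    simp only [Pi.sub_apply]
    cases f x <;> simp
  rw [key]
  exact Submodule.sub_mem _ h1 hf

/-- scaling a degree-`d` strategy by a degree-`D` function gives degree `D + d`. -/
theorem hasDegF_mulStrat {p : ℕ} [Fact p.Prime] {d d' : ℕ} {f : (Fin n → Bool) → Bool}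
    {y : Fin (n + 1) → (Fin n → Bool) → Bool} (hf : HasDegF p f d) (hy : ∀ g, HasDegF p (y g) d')
    (g : Fin (n + 1)) : HasDegF p (mulStrat f y g) (d + d') :=
  hasDegF_and hf (hy g)

section Register
open F4

/-- the `𝔽₄` register of a strategy: `R_y(u) = Σ_g [y_g(u)]·ω^{g + e_g(u)}`. -/
noncomputable def reg (y : Fin (n + 1) → (Fin n → Bool) → Bool) (u : Fin n → Bool) : F4 :=
  ∑ g : Fin (n + 1), ιF (y g u) * ω ^ (g.val + walkExp u g.val)

/-- THE GAME IS A TRACE OF THE REGISTER: `[WIN_c(y)(u)] = tr(ω^c · R_y(u))`. -/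
theorem iotaF_ringWinU_reg (c : ℕ) (y : Fin (n + 1) → (Fin n → Bool) → Bool) (u : Fin n → Bool) :
    ιF (ringWinU c y u) = tr (ω ^ c * reg y u) := by
  rw [iotaF_ringWinU, reg, Finset.mul_sum]
  congr 1
  refine Finset.sum_congr rfl fun g _ => ?_
  rw [show c + g.val + walkExp u g.val = c + (g.val + walkExp u g.val) by ring, pow_add]
  ring

/-- the Boolean embedding `ιF : Bool → F4` is injective. -/
theorem iotaF_injective : Function.Injective ιF := by
  haveI := F4.nontrivial
  intro a b h
  cases a <;> cases b <;> simp [ιF] at h ⊢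

/-- `ιF` turns XOR into addition in `F4`. -/
theorem iotaF_xor (a b : Bool) : ιF (Bool.xor a b) = ιF a + ιF b := by
  cases a <;> cases b <;> simp [ιF, F4.add_self]

/-- `ιF` turns AND into multiplication in `F4`. -/
theorem iotaF_and (a b : Bool) : ιF (a && b) = ιF a * ιF b := by
  cases a <;> cases b <;> simp [ιF]

/-- a parity bit read in `𝔽₄` is the natural number itself. -/
theorem iotaF_decide_odd (k : ℕ) : ιF (decide (k % 2 = 1)) = (k : F4) := by
  rw [natCast_eq]
  unfold ιF
  by_cases h : k % 2 = 1 <;> simp [h]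

/-- `ω^a = ω^b` when `a ≡ b (mod 3)`. -/
theorem omega_pow_congr {a b : ℕ} (h : a % 3 = b % 3) : ω ^ a = ω ^ b := by
  rw [omega_pow_mod a, omega_pow_mod b, h]


end Register
end Summit.QuantumAdvantage.AdviceFreeQNC0.RegisterRotation
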